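import Literature.Computability.Complexity.OrbitDeciders
import Literature.Computability.Complexity.CodeFPStrings
import HarnessLib

/-!
# Recursive orbit deciders: polynomial-space RECURSION — an explicit stack of activation records
# driven by one `FP` step function — decides a `PSPACE` language

Trunk toolkit on top of `OrbitDeciders.lean` (`OrbitDecider A`: an `FP` round function iterated
`2^{poly}` times on polynomially short states decides `A`, hence `A ∈ PSPACE` —
`OrbitDecider.mem_PSPACE`; Arora–Barak 2009, Thm. 4.2 and §4.1). Its sibling
`OrbitDecidersOracle.lean` provides ONE level of suspension (`OracleOrbitDecider.nest`: an orbit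
may call the orbit of a fixed second language); iterating that construction gives recursion of a
FIXED depth only. This file provides recursion of POLYNOMIAL depth, in the textbook form of the
implementation of a recursive procedure on a Turing tape used as a STACK OF ACTIVATION RECORDS
(Homer–Selman 2011, proof of Thm. 5.13 (Savitch): "TEST can be implemented by a stack of
activation records for the calls … we want to see that the depth of the stack is never more than
`m S(n)` … each activation record has size `O(S(n))`. Thus, the total stack size is `O(S²(n))`").

* `RecProc` — the data of a recursive procedure: an `FP` STEP function acting on the active
  activation record (a frame, any string), whose result is tagged CONTINUE (`00·frame'`), CALL
  (`01·callee`: push the callee's initial frame, the caller waits unchanged) or RETURN (`1·value`);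
  an `FP` RESUME function telling how a waiting caller consumes the value returned to it
  (`⟨caller, value⟩ ↦ caller'`); an `FP` initial frame `init w` of the root call on input `w`.
* `RecProc.Cfg`, `RecProc.next` — the small-step semantics on configurations `(stack, out)`
  (stack of frames, top = active record; `out` = the value returned by the root call, junk `[]`
  before): one application of `step` to the top frame, pushing / popping as tagged; the empty
  stack is halted (`next_halted`, `run_stable`). `RecProc.run w k` = `k` steps from `([init w], [])`.
* `RecProc.nextFP` — the semantics is realised ON CODES by a polynomial-time string function, in
  the typed `CodeFP` algebra (`CodeFP.rawCases` on the stack, `strGetD`/`strDrop` for the tag,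
  `of_fn` for `step`/`resume`): no machine is written by hand.
* **`RecProc.mem_PSPACE`** — if along the run the stack depth stays `≤ D(|w|)`, every frame and
  the output stay `≤ S(|w|)` long, and membership is read off the first output bit at round
  `2^{|N w|}` for an `FP` unary clock `N`, then the language is in `PSPACE`: the coded run is the
  orbit of an `OrbitDecider` whose state is `answer-bit · ⟨code of stack, out⟩` (the pair code
  `boolPair [a] _` starts with the symbol `a`), of length `≤ 6 + 2·D·(2S+2) + S`.
  `RecProc.mem_PSPACE_of_halts` — the same with "the root call has returned by round `2^{|N w|}`
  and its first output bit is the answer" (halted configurations are fixed points).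

* §Timing — the run bounds from LOCAL data: a certificate `RecProc.Cert` (an invariant `Inv`
  of activation records, a RANK `rk` strictly decreasing along calls with root rank `≤ d`, a
  POTENTIAL `pot < 2^r` strictly decreasing along the own steps of a record — continue and
  resumption —, sizes `≤ S`) gives: every stack of the run is good (`Cert.good_run`: invariant
  records, strictly ascending ranks, depth `≤ d + 1` by `Cert.length_le_of_asc`), the measure
  `Φ(f₀ :: rest) = (pot f₀ + 1)·K^{rk f₀} + Σ_{g ∈ rest} pot g·K^{rk g}` (`K = 2^r + 1`) drops at
  every step (`Cert.meas_next_lt`), hence the run HALTS within `K^{d+1} ≤ 2^{(r+1)(d+1)}` steps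
  (`Cert.run_halts`), and **`Cert.mem_PSPACE_of_cert`**: if the first bit of the root's returned
  value tells membership, the language is in `PSPACE` — with no global hypothesis left.

HONEST FRAMING (val-lit, KV20 M1 programme brick (P1), RULING (117)): generic
`PSPACE`-recursion infrastructure; by itself it proves nothing about `kumarVolk2020_cor_1_3` or its
hypothesis `hM1`; `VP ≠ VNP` is NOT proved and nothing here bears on it.

## References

* S. Homer, A. L. Selman, *Computability and Complexity Theory*, 2nd ed., Springer 2011, Thm. 5.13
  and its proof, p. 97 (recursive procedures implemented by a stack of activation records on a
  work tape; stack depth × record size bounds the space) [HomerSelman2011].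
* S. Arora, B. Barak, *Computational Complexity: A Modern Approach*, CUP 2009, Thm. 4.2 and §4.1
  (space-bounded computation; reuse of space), Thm. 4.14 (Savitch, the same recursion)
  [AroraBarakCC2009].
-/

noncomputable section

namespace Literature.Computability.Complexity

open _root_.Computability Polynomial CodeFP Brick

/-- **A polynomial-space recursive procedure** (the data; the space bounds are hypotheses of the
theorems): `step` acts on the ACTIVE ACTIVATION RECORD (a frame — any string holding the local
variables and the program point) and returns a tagged word — `false :: false :: frame'` (continue
with the updated frame), `false :: true :: callee` (CALL: push the callee's initial frame; the
caller's frame waits unchanged), `true :: value` (RETURN `value` to the caller) —; `resume` tells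
how a waiting caller's frame absorbs the value returned to it (`⟨caller, value⟩ ↦ caller'`, the pair
coded by `boolPair`); `init w` is the root frame on input `w`. All three are polynomial-time string
functions. [cite: HomerSelman2011, Thm. 5.13 (proof, p. 97: activation records on a stack tape)] -/
structure RecProc where
  /-- one step of the active activation record, tagged continue / call / return -/
  step : List Bool → List Bool
  /-- how a waiting caller consumes a returned value: `boolPair caller value ↦ caller'` -/
  resume : List Bool → List Bool
  /-- the root activation record of an input -/
  init : List Bool → List Bool
  /-- `step` is polynomial-time -/
  step_mem : step ∈ FP
  /-- `resume` is polynomial-time -/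
  resume_mem : resume ∈ FP
  /-- `init` is polynomial-time -/
  init_mem : init ∈ FP

namespace RecProc

variable (P : RecProc)

/-! ### The small-step semantics on an explicit stack -/

/-- A configuration: the STACK of activation records (head = the active one; below it the waiting
callers, innermost first) and the OUTPUT register (the value returned by the root call; `[]` before).
[cite: HomerSelman2011, Thm. 5.13 (proof, p. 97)] -/
abbrev Cfg : Type := List (List Bool) × List Bool

/-- Effect of a RETURN of `value` on the waiting callers: the root's return fills the output
register and empties the stack; otherwise the innermost waiting caller resumes with the value.
[cite: HomerSelman2011, Thm. 5.13 (proof, p. 97: "On return from this recursive call …")] -/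
def onReturn (value out : List Bool) : List (List Bool) → Cfg
  | [] => ([], value)
  | caller :: rest => (P.resume (boolPair caller value) :: rest, out)

/-- One step of the active record `f` above the waiting callers `rest`: dispatch on the tag of
`step f`. [cite: HomerSelman2011, Thm. 5.13 (proof, p. 97)] -/
def stepTop (out f : List Bool) (rest : List (List Bool)) : Cfg :=
  if (P.step f).getD 0 false = true then P.onReturn ((P.step f).drop 1) out rest
  else if (P.step f).getD 1 false = true then ((P.step f).drop 2 :: f :: rest, out)
  else ((P.step f).drop 2 :: rest, out)

/-- **The small-step semantics**: a halted configuration (empty stack) is fixed; otherwise the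
active record makes one step. [cite: HomerSelman2011, Thm. 5.13 (proof, p. 97)] -/
def next (c : Cfg) : Cfg :=
  match c.1 with
  | [] => c
  | f :: rest => P.stepTop c.2 f rest

/-- The initial configuration of an input: the root record alone, empty output. [cite: HomerSelman2011, Thm. 5.13 (proof, p. 97: "The initial call")] -/
def cfg₀ (w : List Bool) : Cfg := ([P.init w], [])

/-- **The run**: `k` steps from the initial configuration. [cite: HomerSelman2011, Thm. 5.13 (proof, p. 97)] -/
def run (w : List Bool) (k : ℕ) : Cfg := P.next^[k] (P.cfg₀ w)

/-- A halted configuration is a fixed point. [cite: HomerSelman2011, Thm. 5.13 (proof, p. 97)] -/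
@[simp] theorem next_halted (out : List Bool) : P.next (([] : List (List Bool)), out) = ([], out) := rfl

/-- `run w (k+1) = next (run w k)` (one more step of the procedure). [cite: HomerSelman2011, Thm. 5.13 (proof, p. 97)] -/
theorem run_succ (w : List Bool) (k : ℕ) : P.run w (k + 1) = P.next (P.run w k) := by
  rw [run, Function.iterate_succ_apply', ← run]

/-- A configuration with empty stack is fixed. [cite: HomerSelman2011, Thm. 5.13 (proof, p. 97)] -/
theorem next_of_halted {c : Cfg} (h : c.1 = []) : P.next c = c := by
  obtain ⟨st, out⟩ := c
  simp only at h
  subst h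
  rfl

/-- Once halted, the run is constant. [cite: HomerSelman2011, Thm. 5.13 (proof, p. 97)] -/
theorem run_stable {w : List Bool} {k : ℕ} (h : (P.run w k).1 = []) : ∀ j, k ≤ j → P.run w j = P.run w k := by
  intro j hj
  obtain ⟨d, rfl⟩ := Nat.exists_eq_add_of_le hj
  induction d with
  | zero => rfl
  | succ d ih =>
    rw [show k + (d + 1) = (k + d) + 1 by omega, run_succ, ih (by omega)]
    exact P.next_of_halted h

/-! ### The semantics on codes, in the typed `CodeFP` algebra -/

/-- Code of a configuration: `⟨raw list code of the stack, out⟩`. [cite: AroraBarak2009, §0.1] -/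
abbrev cfgE : Cfg → List Bool := pairE (rawE strE) strE

/-- The state of the orbit: the answer bit in front of the configuration. [cite: AroraBarak2009, §0.1] -/
abbrev St : Type := Bool × Cfg

/-- Code of a state: `boolPair [a] (code of the configuration)` — its FIRST SYMBOL is `a`. [cite: AroraBarak2009, §0.1] -/
abbrev stE : St → List Bool := pairE bitE cfgE

/-- The head symbol of a state code is the answer bit. [cite: AroraBarak2009, §0.1] -/
theorem headI_stE (x : St) : (stE x).headI = x.1 := by
  obtain ⟨a, c⟩ := x
  simp [bitE, boolPair]

/-- `step` on codes (the identity encoder of strings). [cite: AroraBarak2009, §1.3] -/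
private theorem stepFP : CodeFP strE strE P.step := of_fn P.step P.step_mem fun _ => rfl

/-- `resume` on codes: the pair code IS `boolPair`. [cite: AroraBarak2009, §1.3] -/
private theorem resumeFP : CodeFP (pairE strE strE) strE (fun p => P.resume (boolPair p.1 p.2)) :=
  of_fn P.resume P.resume_mem fun _ => rfl

/-- **`stepTop` is computed on codes** (context `t = (out, f, rest)`). [cite: HomerSelman2011, Thm. 5.13 (proof, p. 97)] [cite: AroraBarak2009, §1.3] -/
private theorem stepTopFP :
    CodeFP (pairE strE (pairE strE (rawE strE))) cfgE (fun t => P.stepTop t.1 t.2.1 t.2.2) := by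
  -- the pieces of the context
  have hout : CodeFP (pairE strE (pairE strE (rawE strE))) strE (fun t => t.1) := fst _ _
  have hf : CodeFP (pairE strE (pairE strE (rawE strE))) strE (fun t => t.2.1) := (snd _ _).fst'
  have hrest : CodeFP (pairE strE (pairE strE (rawE strE))) (rawE strE) (fun t => t.2.2) := (snd _ _).snd'
  have hr : CodeFP (pairE strE (pairE strE (rawE strE))) strE (fun t => P.step t.2.1) := P.stepFP.comp hf
  have hb0 : CodeFP (pairE strE (pairE strE (rawE strE))) bitE (fun t => (P.step t.2.1).getD 0 false) :=
    strGetD.comp ((const _ 0).pair hr)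
  have hb1 : CodeFP (pairE strE (pairE strE (rawE strE))) bitE (fun t => (P.step t.2.1).getD 1 false) :=
    strGetD.comp ((const _ 1).pair hr)
  have hd1 : CodeFP (pairE strE (pairE strE (rawE strE))) strE (fun t => (P.step t.2.1).drop 1) :=
    strDrop.comp ((const _ 1).pair hr)
  have hd2 : CodeFP (pairE strE (pairE strE (rawE strE))) strE (fun t => (P.step t.2.1).drop 2) :=
    strDrop.comp ((const _ 2).pair hr)
  -- RETURN: case on the waiting callers (context = the whole `t`, list = `t.2.2`)
  have hnil : CodeFP (pairE strE (pairE strE (rawE strE))) cfgE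
      (fun t => (([] : List (List Bool)), (P.step t.2.1).drop 1)) :=
    (const _ ([] : List (List Bool))).pair hd1
  have hcons : CodeFP (pairE (pairE strE (pairE strE (rawE strE))) (pairE strE (rawE strE))) cfgE
      (fun q => (P.resume (boolPair q.2.1 ((P.step q.1.2.1).drop 1)) :: q.2.2, q.1.1)) :=
    ((rawCons strE).comp ((P.resumeFP.comp ((snd _ _).fst'.pair (hd1.comp (fst _ _)))).pair (snd _ _).snd')).pair
      (hout.comp (fst _ _))
  have hret : CodeFP (pairE strE (pairE strE (rawE strE))) cfgE
      (fun t => P.onReturn ((P.step t.2.1).drop 1) t.1 t.2.2) :=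
    ((rawCases (k := fun t l => P.onReturn ((P.step t.2.1).drop 1) t.1 l) hnil hcons
      (fun _ => rfl) (fun _ _ _ => rfl)).comp ((CodeFP.id _).pair hrest)).congr fun _ => rfl
  -- CALL and CONTINUE
  have hcall : CodeFP (pairE strE (pairE strE (rawE strE))) cfgE
      (fun t => ((P.step t.2.1).drop 2 :: t.2.1 :: t.2.2, t.1)) :=
    ((rawCons strE).comp (hd2.pair ((rawCons strE).comp (hf.pair hrest)))).pair hout
  have hcont : CodeFP (pairE strE (pairE strE (rawE strE))) cfgE
      (fun t => ((P.step t.2.1).drop 2 :: t.2.2, t.1)) :=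
    ((rawCons strE).comp (hd2.pair hrest)).pair hout
  exact (hb0.ite hret (hb1.ite hcall hcont)).congr fun t => by simp only [stepTop]

/-- **The small-step semantics is computed on codes**: `next` is `CodeFP`. [cite: HomerSelman2011, Thm. 5.13 (proof, p. 97)] [cite: AroraBarak2009, §1.3] -/
theorem nextFP : CodeFP cfgE cfgE P.next := by
  have hk : CodeFP (pairE strE (rawE strE)) cfgE (fun p => P.next (p.2, p.1)) :=
    rawCases (k := fun out st => P.next (st, out)) ((const _ ([] : List (List Bool))).pair (CodeFP.id strE))
      P.stepTopFP (fun _ => rfl) (fun _ _ _ => rfl)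
  exact (hk.comp ((snd _ _).pair (fst _ _))).congr fun c => by rfl

/-- One ROUND of the orbit: step the configuration and refresh the answer bit (first output bit).
[cite: HomerSelman2011, Thm. 5.13 (proof, p. 97)] -/
def round (x : St) : St := ((P.next x.2).2.getD 0 false, P.next x.2)

/-- The round is computed on codes. [cite: AroraBarak2009, §1.3] -/
theorem roundFP : CodeFP stE stE P.round := by
  have hn : CodeFP stE cfgE (fun x => P.next x.2) := P.nextFP.comp (snd _ _)
  exact ((strGetD.comp ((const _ 0).pair hn.snd')).pair hn).congr fun _ => rfl

/-- After `k` rounds the configuration is `next^[k]` (the orbit simulates the run). [cite: HomerSelman2011, Thm. 5.13 (proof, p. 97)] -/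
theorem round_iterate_snd (x : St) (k : ℕ) : (P.round^[k] x).2 = P.next^[k] x.2 := by
  induction k generalizing x with
  | zero => rfl
  | succ k ih => rw [Function.iterate_succ_apply, Function.iterate_succ_apply, ih]; rfl

/-- After `k + 1` rounds the answer bit is the first output bit of the configuration. [cite: HomerSelman2011, Thm. 5.13 (proof, p. 97)] -/
theorem round_iterate_fst (x : St) (k : ℕ) :
    (P.round^[k + 1] x).1 = (P.next^[k + 1] x.2).2.getD 0 false := by
  rw [Function.iterate_succ_apply', ← round_iterate_snd, Function.iterate_succ_apply']
  rfl

/-! ### Space bookkeeping -/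

/-- Length of a raw list code with uniformly bounded items. [cite: AroraBarak2009, §0.1] -/
private theorem length_rawE_strE_le {L : List (List Bool)} {b : ℕ} (h : ∀ a ∈ L, a.length ≤ b) :
    (rawE strE L).length ≤ L.length * (2 * b + 2) := by
  induction L with
  | nil => simp
  | cons a L ih =>
    rw [rawE_cons, length_boolPair, List.length_cons]
    have h1 := h a (by simp)
    have h2 := ih fun a' ha' => h a' (by simp [ha'])
    have h3 : (L.length + 1) * (2 * b + 2) = L.length * (2 * b + 2) + (2 * b + 2) := by ring
    change 2 * a.length + 2 + (rawE strE L).length ≤ _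
    omega

/-- **Space of a state**: answer bit, stack of `≤ D` records of length `≤ S`, output `≤ S` ⇒ code
length `≤ 6 + 2·D·(2S+2) + S` ("the total stack size is" depth × record size).
[cite: HomerSelman2011, Thm. 5.13 (proof, p. 97)] -/
theorem length_stE_le {a : Bool} {c : Cfg} {D S : ℕ} (hd : c.1.length ≤ D) (hf : ∀ f ∈ c.1, f.length ≤ S)
    (ho : c.2.length ≤ S) : (stE (a, c)).length ≤ 6 + 2 * (D * (2 * S + 2)) + S := by
  obtain ⟨st, out⟩ := c
  have h1 := length_rawE_strE_le hf
  have h2 : st.length * (2 * S + 2) ≤ D * (2 * S + 2) := Nat.mul_le_mul_right _ hd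
  simp only [pairE_apply, bitE, strE, id_eq, length_boolPair, List.length_singleton] at *
  omega

/-! ### The `PSPACE` theorem -/

/-- The coded initial state `⟨0, ⟨[init w], ε⟩⟩` is computed in polynomial time. [cite: AroraBarak2009, §1.3] -/
private theorem initStFP : CodeFP strE stE (fun w => ((false : Bool), P.cfg₀ w)) := by
  have hinit : CodeFP strE strE P.init := of_fn P.init P.init_mem fun _ => rfl
  have hst : CodeFP strE (rawE strE) (fun w => [P.init w]) :=
    ((rawCons strE).comp (hinit.pair (const _ ([] : List (List Bool))))).congr fun _ => rfl
  have hcfg : CodeFP strE cfgE (fun w => P.cfg₀ w) := (hst.pair (const _ ([] : List Bool))).congr fun _ => rfl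
  exact (const _ false).pair hcfg

/-- Simulation: the orbit of the coded round function is the code of the iterated round. [folklore] -/
private theorem iterate_code {F : List Bool → List Bool} (hF : ∀ x : St, F (stE x) = stE (P.round x))
    (x : St) (k : ℕ) : F^[k] (stE x) = stE (P.round^[k] x) := by
  induction k generalizing x with
  | zero => rfl
  | succ k ih => rw [Function.iterate_succ_apply, Function.iterate_succ_apply, hF, ih]

/-- **A polynomial-space recursive procedure decides a `PSPACE` language.** If along the run from
the root record the stack depth is `≤ D(|w|)`, every activation record and the output are
`≤ S(|w|)` long, and `w ∈ L` iff the first output bit at round `2^{|N w|}` is `1` for an `FP`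
unary clock `N`, then `L ∈ PSPACE` — the coded run is an `OrbitDecider` for `L`.
[cite: HomerSelman2011, Thm. 5.13 (proof, p. 97)] [cite: AroraBarakCC2009, Thm. 4.2 and §4.1] -/
theorem mem_PSPACE {L : Language Bool} {N : List Bool → List Bool} (hN : N ∈ FP) (D S : Polynomial ℕ)
    (hdepth : ∀ w k, (P.run w k).1.length ≤ D.eval w.length)
    (hframe : ∀ w k, ∀ f ∈ (P.run w k).1, f.length ≤ S.eval w.length)
    (hout : ∀ w k, (P.run w k).2.length ≤ S.eval w.length)
    (hL : ∀ w, w ∈ L ↔ (P.run w (2 ^ (N w).length)).2.getD 0 false = true) : L ∈ PSPACE := by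
  obtain ⟨sN, hsN⟩ := exists_poly_length_le_of_mem_FP hN
  obtain ⟨F, hF, hFr⟩ := P.roundFP
  obtain ⟨I, hI, hIr⟩ := P.initStFP
  have horbit : ∀ w k, F^[k] (I w) = stE (P.round^[k] (false, P.cfg₀ w)) := fun w k => by
    rw [show I w = stE (false, P.cfg₀ w) from hIr w]
    exact P.iterate_code hFr _ k
  refine OrbitDecider.mem_PSPACE
    { F := F, F_mem := hF, ι := I, ι_mem := hI, Nu := N, Nu_mem := hN,
      s := C 6 + 2 * (D * (2 * S + 2)) + S + sN,
      Nu_le := fun w => ?_, size_le := fun w k => ?_, correct := fun w => ?_ }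
  · have := hsN w
    simp only [eval_add, eval_mul, eval_C, eval_ofNat]
    omega
  · rw [horbit]
    have hc : (P.round^[k] (false, P.cfg₀ w)).2 = P.run w k := P.round_iterate_snd (false, P.cfg₀ w) k
    have hd := hdepth w k
    have hf := hframe w k
    have ho := hout w k
    rw [← hc] at hd hf ho
    refine (length_stE_le (a := (P.round^[k] (false, P.cfg₀ w)).1) hd hf ho).trans ?_
    simp only [eval_add, eval_mul, eval_C, eval_ofNat]
    omega
  · rw [horbit, hL w, headI_stE]
    obtain ⟨T, hT⟩ : ∃ T, 2 ^ (N w).length = T + 1 := ⟨2 ^ (N w).length - 1, by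
      have := Nat.one_le_two_pow (n := (N w).length); omega⟩
    rw [hT, P.round_iterate_fst (false, P.cfg₀ w) T]
    rfl

/-- **Variant: halting form.** If, in addition to the space bounds, the root call has RETURNED by
round `2^{|N w|}` (empty stack at some earlier round) with first output bit `[w ∈ L]`, then
`L ∈ PSPACE` (halted configurations are fixed, `run_stable`). [cite: HomerSelman2011, Thm. 5.13 (proof, p. 97)] [cite: AroraBarakCC2009, Thm. 4.2 and §4.1] -/
theorem mem_PSPACE_of_halts {L : Language Bool} {N : List Bool → List Bool} (hN : N ∈ FP) (D S : Polynomial ℕ)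
    (hdepth : ∀ w k, (P.run w k).1.length ≤ D.eval w.length)
    (hframe : ∀ w k, ∀ f ∈ (P.run w k).1, f.length ≤ S.eval w.length)
    (hout : ∀ w k, (P.run w k).2.length ≤ S.eval w.length)
    (hhalt : ∀ w, ∃ k, k ≤ 2 ^ (N w).length ∧ (P.run w k).1 = [] ∧
      (w ∈ L ↔ (P.run w k).2.getD 0 false = true)) : L ∈ PSPACE := by
  refine P.mem_PSPACE hN D S hdepth hframe hout fun w => ?_
  obtain ⟨k, hk, hhalted, hiff⟩ := hhalt w
  rw [P.run_stable hhalted _ hk]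
  exact hiff

/-! ### Timing: space and halting bounds from a local certificate

The consumer's obligations are LOCAL (about one activation record at a time): an invariant `Inv`
of records, a RANK `rk` that strictly decreases along calls (bounding the recursion depth) and a
POTENTIAL `pot` that strictly decreases along the own steps of a record (continue, resume),
bounded by `2^{r}`. From these: every stack of the run is a chain of records of strictly increasing
ranks (depth `≤ d + 1`), every record is `≤ S` long, and the run HALTS within
`(2^r + 1)^{d+1} ≤ 2^{(r+1)(d+1)}` steps, by the strictly decreasing measure
`Φ(f₀ :: rest) = (pot f₀ + 1)·K^{rk f₀} + Σ_{g ∈ rest} pot g · K^{rk g}`, `K = 2^r + 1`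
(Homer–Selman: "the depth of the stack is never more than `m S(n)` … each call decrements the
value of `i` by 1"). -/

section Timing

/-- **A local certificate** for a recursive procedure: an invariant `Inv w f` of activation records
on input `w`, a rank `rk w f` (a callee's rank is smaller than its caller's; the root's is
`≤ d(|w|)`; own steps do not increase it) and a potential `pot w f < 2^{r(|w|)}` strictly decreasing
at every own step of a record (continue; resumption after a call), with records and returned
values of length `≤ S(|w|)`. [cite: HomerSelman2011, Thm. 5.13 (proof, p. 97: "each successive call decrements the value of i by 1 … each activation record has size O(S(n))")] -/
structure Cert (P : RecProc) where
  /-- invariant of the activation records reachable on input `w` -/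
  Inv : List Bool → List Bool → Prop
  /-- rank: strictly smaller for a callee than for its caller -/
  rk : List Bool → List Bool → ℕ
  /-- potential: strictly decreasing along the own steps of a record -/
  pot : List Bool → List Bool → ℕ
  /-- depth polynomial (bound on the root's rank) -/
  d : Polynomial ℕ
  /-- log of the potential bound -/
  r : Polynomial ℕ
  /-- size polynomial (records and returned values) -/
  S : Polynomial ℕ
  /-- the root record satisfies the invariant -/
  init_inv : ∀ w, Inv w (P.init w)
  /-- the root's rank is `≤ d` -/
  init_rk : ∀ w, rk w (P.init w) ≤ d.eval w.length
  /-- invariant records are short -/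
  size_le : ∀ w f, Inv w f → f.length ≤ S.eval w.length
  /-- the potential is `< 2^r` -/
  pot_lt : ∀ w f, Inv w f → pot w f < 2 ^ r.eval w.length
  /-- CONTINUE steps keep the invariant, decrease the potential, do not increase the rank -/
  cont : ∀ w f, Inv w f → (P.step f).getD 0 false = false → (P.step f).getD 1 false = false →
    Inv w ((P.step f).drop 2) ∧ pot w ((P.step f).drop 2) < pot w f ∧ rk w ((P.step f).drop 2) ≤ rk w f
  /-- CALL steps push an invariant record of smaller rank -/
  call : ∀ w f, Inv w f → (P.step f).getD 0 false = false → (P.step f).getD 1 false = true →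
    Inv w ((P.step f).drop 2) ∧ rk w ((P.step f).drop 2) < rk w f
  /-- RETURN steps return short values -/
  ret : ∀ w f, Inv w f → (P.step f).getD 0 false = true → ((P.step f).drop 1).length ≤ S.eval w.length
  /-- RESUMPTION of a waiting caller `f` (an invariant record whose step was a call) with the value
  returned by an invariant record `g`: invariant, smaller potential, rank not increased -/
  res : ∀ w f g, Inv w f → (P.step f).getD 0 false = false → (P.step f).getD 1 false = true →
    Inv w g → (P.step g).getD 0 false = true →
      Inv w (P.resume (boolPair f ((P.step g).drop 1))) ∧
        pot w (P.resume (boolPair f ((P.step g).drop 1))) < pot w f ∧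
        rk w (P.resume (boolPair f ((P.step g).drop 1))) ≤ rk w f

namespace Cert

variable {P}
variable (C : Cert P)

/-- A WAITING record: invariant, and its step is a call. [cite: HomerSelman2011, Thm. 5.13 (proof, p. 97)] -/
def Waiting (w f : List Bool) : Prop :=
  C.Inv w f ∧ (P.step f).getD 0 false = false ∧ (P.step f).getD 1 false = true

/-- Strictly ascending ranks from the top of the stack downwards. [cite: HomerSelman2011, Thm. 5.13 (proof, p. 97)] -/
def Asc (w : List Bool) : List (List Bool) → Prop
  | [] => True
  | [_] => True
  | a :: b :: l => C.rk w a < C.rk w b ∧ Asc w (b :: l)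

/-- **Good stacks**: invariant top, waiting callers below, strictly ascending ranks, all ranks `≤ d`.
[cite: HomerSelman2011, Thm. 5.13 (proof, p. 97)] -/
def Good (w : List Bool) (st : List (List Bool)) : Prop :=
  (∀ f rest, st = f :: rest → C.Inv w f ∧ ∀ g ∈ rest, C.Waiting w g) ∧ C.Asc w st ∧
    ∀ g ∈ st, C.rk w g ≤ C.d.eval w.length

/-- The tail of an ascending stack is ascending. [folklore] -/
private theorem asc_tail {w : List Bool} {a : List Bool} {l : List (List Bool)} (h : C.Asc w (a :: l)) :
    C.Asc w l := by
  cases l with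
  | nil => trivial
  | cons b l => exact h.2

/-- Replacing the top by a record of no larger rank keeps the stack ascending. [folklore] -/
private theorem asc_replace {w : List Bool} {a a' : List Bool} {l : List (List Bool)}
    (hle : C.rk w a' ≤ C.rk w a) (h : C.Asc w (a :: l)) : C.Asc w (a' :: l) := by
  cases l with
  | nil => trivial
  | cons b l => exact ⟨lt_of_le_of_lt hle h.1, h.2⟩

/-- **Depth bound**: an ascending stack with ranks `≤ d` has at most `d + 1` records. [cite: HomerSelman2011, Thm. 5.13 (proof, p. 97: "the depth of the stack is never more than m S(n)")] -/
theorem length_le_of_asc {w : List Bool} {d : ℕ} : ∀ {st : List (List Bool)}, C.Asc w st →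
    (∀ g ∈ st, C.rk w g ≤ d) → st.length ≤ d + 1
  | [], _, _ => by simp
  | [a], _, _ => by simp
  | a :: b :: l, h, hd => by
    -- ranks `rk a < rk b < …` : the length of `b :: l` is at most `d + 1 - (rk a + 1) + …`
    have key : ∀ (st : List (List Bool)) (f : List Bool), C.Asc w (f :: st) → (∀ g ∈ f :: st, C.rk w g ≤ d) →
        C.rk w f + (f :: st).length ≤ d + 1 := by
      intro st
      induction st with
      | nil => intro f _ hd; have := hd f (by simp); simp; omega
      | cons g st ih =>
        intro f h hd
        have h1 : C.rk w f < C.rk w g := h.1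
        have h2 := ih g h.2 (fun x hx => hd x (by simp [hx]))
        simp only [List.length_cons] at h2 ⊢
        omega
    have := key (b :: l) a h hd
    omega

/-- The initial stack is good. [cite: HomerSelman2011, Thm. 5.13 (proof, p. 97: "The initial call")] -/
theorem good_init (w : List Bool) : C.Good w [P.init w] := by
  refine ⟨fun f rest h => ?_, trivial, fun g hg => ?_⟩
  · obtain ⟨rfl, rfl⟩ := List.cons.inj h
    exact ⟨C.init_inv w, fun g hg => by simp at hg⟩
  · rw [List.mem_singleton] at hg
    subst hg
    exact C.init_rk w

/-- **Good stacks are preserved by a step.** [cite: HomerSelman2011, Thm. 5.13 (proof, p. 97)] -/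
theorem good_next {w : List Bool} {c : Cfg} (h : C.Good w c.1) : C.Good w (P.next c).1 := by
  obtain ⟨st, out⟩ := c
  cases st with
  | nil => exact h
  | cons f rest =>
    obtain ⟨htop, hasc, hrk⟩ := h
    obtain ⟨hf, hwait⟩ := htop f rest rfl
    show C.Good w (P.stepTop out f rest).1
    unfold stepTop
    by_cases h0 : (P.step f).getD 0 false = true
    · -- RETURN
      rw [if_pos h0]
      cases rest with
      | nil => exact ⟨fun f' rest' h => by simp [onReturn] at h, trivial, fun g hg => by simp [onReturn] at hg⟩
      | cons c rest' =>
        obtain ⟨hcI, hc0, hc1⟩ := hwait c (by simp)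
        obtain ⟨hI', -, hrk'⟩ := C.res w c f hcI hc0 hc1 hf h0
        refine ⟨fun f' rest'' h => ?_, ?_, fun g hg => ?_⟩
        · simp only [onReturn, List.cons.injEq] at h
          obtain ⟨rfl, rfl⟩ := h
          exact ⟨hI', fun g hg => hwait g (by simp [hg])⟩
        · exact C.asc_replace hrk' (C.asc_tail hasc)
        · simp only [onReturn, List.mem_cons] at hg
          rcases hg with rfl | hg
          · exact hrk'.trans (hrk c (by simp))
          · exact hrk g (by simp [hg])
    · have h0' : (P.step f).getD 0 false = false := by simpa using h0
      rw [if_neg h0]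
      by_cases h1 : (P.step f).getD 1 false = true
      · -- CALL
        rw [if_pos h1]
        obtain ⟨hgI, hgrk⟩ := C.call w f hf h0' h1
        refine ⟨fun f' rest' h => ?_, ⟨hgrk, hasc⟩, fun g hg => ?_⟩
        · simp only [List.cons.injEq] at h
          obtain ⟨rfl, rfl⟩ := h
          refine ⟨hgI, fun g hg => ?_⟩
          simp only [List.mem_cons] at hg
          rcases hg with rfl | hg
          · exact ⟨hf, h0', h1⟩
          · exact hwait g hg
        · simp only [List.mem_cons] at hg
          rcases hg with rfl | hg
          · exact (le_of_lt hgrk).trans (hrk f (by simp))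
          · exact hrk g (by simpa using hg)
      · -- CONTINUE
        have h1' : (P.step f).getD 1 false = false := by simpa using h1
        rw [if_neg h1]
        obtain ⟨hI', -, hrk'⟩ := C.cont w f hf h0' h1'
        refine ⟨fun f' rest' h => ?_, C.asc_replace hrk' hasc, fun g hg => ?_⟩
        · simp only [List.cons.injEq] at h
          obtain ⟨rfl, rfl⟩ := h
          exact ⟨hI', hwait⟩
        · simp only [List.mem_cons] at hg
          rcases hg with rfl | hg
          · exact hrk'.trans (hrk f (by simp))
          · exact hrk g (by simp [hg])

/-- The output register is empty or a short returned value, and this is preserved. [cite: HomerSelman2011, Thm. 5.13 (proof, p. 97)] -/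
theorem out_next {w : List Bool} {c : Cfg} (hg : C.Good w c.1) (ho : c.2.length ≤ C.S.eval w.length) :
    (P.next c).2.length ≤ C.S.eval w.length := by
  obtain ⟨st, out⟩ := c
  cases st with
  | nil => exact ho
  | cons f rest =>
    obtain ⟨hf, -⟩ := hg.1 f rest rfl
    show (P.stepTop out f rest).2.length ≤ _
    unfold stepTop
    by_cases h0 : (P.step f).getD 0 false = true
    · rw [if_pos h0]
      cases rest with
      | nil => exact C.ret w f hf h0
      | cons c rest' => exact ho
    · rw [if_neg h0]
      by_cases h1 : (P.step f).getD 1 false = true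
      · rw [if_pos h1]; exact ho
      · rw [if_neg h1]; exact ho

/-- **Every stack of the run is good, every output short.** [cite: HomerSelman2011, Thm. 5.13 (proof, p. 97)] -/
theorem good_run (w : List Bool) (k : ℕ) : C.Good w (P.run w k).1 ∧ (P.run w k).2.length ≤ C.S.eval w.length := by
  induction k with
  | zero => exact ⟨C.good_init w, Nat.zero_le _⟩
  | succ k ih =>
    rw [run_succ]
    exact ⟨C.good_next ih.1, C.out_next ih.1 ih.2⟩

/-! #### The halting measure -/

/-- The base `K = 2^r + 1` of the measure. [cite: HomerSelman2011, Thm. 5.13 (proof, p. 97)] -/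
def base (w : List Bool) : ℕ := 2 ^ C.r.eval w.length + 1

/-- The weight of a waiting record: `pot · K^{rk}`. [cite: HomerSelman2011, Thm. 5.13 (proof, p. 97)] -/
def wt (w f : List Bool) : ℕ := C.pot w f * C.base w ^ C.rk w f

/-- **The halting measure of a stack**: `(pot f₀ + 1)·K^{rk f₀} + Σ_{waiting g} pot g · K^{rk g}`
(zero on the empty stack). [cite: HomerSelman2011, Thm. 5.13 (proof, p. 97)] -/
def meas (w : List Bool) : List (List Bool) → ℕ
  | [] => 0
  | f :: rest => (C.pot w f + 1) * C.base w ^ C.rk w f + (rest.map (C.wt w)).sum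

/-- The base is positive. [folklore] -/
private theorem base_pos (w : List Bool) : 0 < C.base w := Nat.succ_pos _

/-- A record of no larger rank and smaller potential weighs less, with room for one step. [folklore] -/
private theorem succ_mul_pow_le {w f f' : List Bool} (hpot : C.pot w f' < C.pot w f) (hrk : C.rk w f' ≤ C.rk w f) :
    (C.pot w f' + 1) * C.base w ^ C.rk w f' ≤ C.pot w f * C.base w ^ C.rk w f :=
  Nat.mul_le_mul (by omega) (Nat.pow_le_pow_right (C.base_pos w) hrk)

/-- **The measure strictly decreases at every step of a good nonempty stack.** [cite: HomerSelman2011, Thm. 5.13 (proof, p. 97)] -/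
theorem meas_next_lt {w : List Bool} {c : Cfg} (hg : C.Good w c.1) (hne : c.1 ≠ []) :
    C.meas w (P.next c).1 < C.meas w c.1 := by
  obtain ⟨st, out⟩ := c
  cases st with
  | nil => exact absurd rfl hne
  | cons f rest =>
    obtain ⟨htop, hasc, -⟩ := hg
    obtain ⟨hf, hwait⟩ := htop f rest rfl
    have hKpos : 1 ≤ C.base w ^ C.rk w f := Nat.one_le_pow _ _ (C.base_pos w)
    have hl : 0 < (C.pot w f + 1) * C.base w ^ C.rk w f := Nat.mul_pos (Nat.succ_pos _) hKpos
    show C.meas w (P.stepTop out f rest).1 < C.meas w (f :: rest)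
    unfold stepTop
    by_cases h0 : (P.step f).getD 0 false = true
    · rw [if_pos h0]
      cases rest with
      | nil =>
        -- the root returns: the measure drops to `0`
        show C.meas w [] < C.meas w [f]
        simp only [meas, List.map_nil, List.sum_nil, add_zero]
        exact Nat.mul_pos (Nat.succ_pos _) hKpos
      | cons c rest' =>
        obtain ⟨hcI, hc0, hc1⟩ := hwait c (by simp)
        obtain ⟨-, hpot', hrk'⟩ := C.res w c f hcI hc0 hc1 hf h0
        show C.meas w (P.resume (boolPair c ((P.step f).drop 1)) :: rest') < C.meas w (f :: c :: rest')
        simp only [meas, List.map_cons, List.sum_cons, wt]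
        have := C.succ_mul_pow_le hpot' hrk'
        omega
    · have h0' : (P.step f).getD 0 false = false := by simpa using h0
      rw [if_neg h0]
      by_cases h1 : (P.step f).getD 1 false = true
      · -- CALL: `(pot g + 1) K^{rk g} < K^{rk f}` since `pot g + 1 ≤ 2^r < K` and `rk g < rk f`
        rw [if_pos h1]
        obtain ⟨hgI, hgrk⟩ := C.call w f hf h0' h1
        show C.meas w ((P.step f).drop 2 :: f :: rest) < C.meas w (f :: rest)
        simp only [meas, List.map_cons, List.sum_cons, wt]
        have hp : C.pot w ((P.step f).drop 2) + 1 ≤ 2 ^ C.r.eval w.length := C.pot_lt w _ hgI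
        have hK : (C.pot w ((P.step f).drop 2) + 1) * C.base w ^ C.rk w ((P.step f).drop 2) <
            C.base w ^ C.rk w f := by
          calc (C.pot w ((P.step f).drop 2) + 1) * C.base w ^ C.rk w ((P.step f).drop 2)
              < C.base w * C.base w ^ C.rk w ((P.step f).drop 2) :=
                Nat.mul_lt_mul_of_pos_right (Nat.lt_succ_of_le hp) (Nat.one_le_pow _ _ (C.base_pos w))
            _ = C.base w ^ (C.rk w ((P.step f).drop 2) + 1) := by ring
            _ ≤ C.base w ^ C.rk w f := Nat.pow_le_pow_right (C.base_pos w) hgrk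
        have hsplit : (C.pot w f + 1) * C.base w ^ C.rk w f = C.pot w f * C.base w ^ C.rk w f + C.base w ^ C.rk w f := by
          ring
        omega
      · -- CONTINUE
        have h1' : (P.step f).getD 1 false = false := by simpa using h1
        rw [if_neg h1]
        obtain ⟨-, hpot', hrk'⟩ := C.cont w f hf h0' h1'
        show C.meas w ((P.step f).drop 2 :: rest) < C.meas w (f :: rest)
        simp only [meas]
        have := C.succ_mul_pow_le hpot' hrk'
        have hsplit : (C.pot w f + 1) * C.base w ^ C.rk w f = C.pot w f * C.base w ^ C.rk w f + C.base w ^ C.rk w f := by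
          ring
        omega

/-- The initial measure is `< K^{d+1}`. [cite: HomerSelman2011, Thm. 5.13 (proof, p. 97)] -/
theorem meas_init_lt (w : List Bool) : C.meas w [P.init w] < C.base w ^ (C.d.eval w.length + 1) := by
  simp only [meas, List.map_nil, List.sum_nil, add_zero]
  have hp : C.pot w (P.init w) + 1 ≤ 2 ^ C.r.eval w.length := C.pot_lt w _ (C.init_inv w)
  calc (C.pot w (P.init w) + 1) * C.base w ^ C.rk w (P.init w)
      < C.base w * C.base w ^ C.rk w (P.init w) :=
        Nat.mul_lt_mul_of_pos_right (Nat.lt_succ_of_le hp) (Nat.one_le_pow _ _ (C.base_pos w))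
    _ = C.base w ^ (C.rk w (P.init w) + 1) := by ring
    _ ≤ C.base w ^ (C.d.eval w.length + 1) :=
        Nat.pow_le_pow_right (C.base_pos w) (Nat.succ_le_succ (C.init_rk w))

/-- `K^{d+1} ≤ 2^{(r+1)(d+1)}`. [folklore] -/
private theorem base_pow_le (w : List Bool) :
    C.base w ^ (C.d.eval w.length + 1) ≤ 2 ^ ((C.r.eval w.length + 1) * (C.d.eval w.length + 1)) := by
  rw [pow_mul]
  refine Nat.pow_le_pow_left ?_ _
  unfold base
  rw [pow_succ]
  have := Nat.one_le_two_pow (n := C.r.eval w.length)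
  omega

/-- **Halting**: either the run has halted at round `k`, or the measure has dropped by `k`. [cite: HomerSelman2011, Thm. 5.13 (proof, p. 97)] -/
theorem halted_or_meas_le (w : List Bool) (k : ℕ) :
    (P.run w k).1 = [] ∨ C.meas w (P.run w k).1 + k ≤ C.meas w [P.init w] := by
  induction k with
  | zero => exact Or.inr (le_of_eq rfl)
  | succ k ih =>
    by_cases hne : (P.run w k).1 = []
    · exact Or.inl (by rw [P.run_stable hne (k + 1) (by omega)]; exact hne)
    · rcases ih with h | h
      · exact absurd h hne
      · right
        have := C.meas_next_lt (C.good_run w k).1 hne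
        rw [run_succ]
        omega

/-- **The run halts within `2^{(r+1)(d+1)}` steps.** [cite: HomerSelman2011, Thm. 5.13 (proof, p. 97)] -/
theorem run_halts (w : List Bool) {k : ℕ} (hk : 2 ^ ((C.r.eval w.length + 1) * (C.d.eval w.length + 1)) ≤ k) :
    (P.run w k).1 = [] := by
  rcases C.halted_or_meas_le w k with h | h
  · exact h
  · exfalso
    have h1 := C.meas_init_lt w
    have h2 := C.base_pow_le w
    omega

/-- The unary clock `1^{(r+1)(d+1)}` of the recursion. [cite: HomerSelman2011, Thm. 5.13 (proof, p. 97)] -/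
def clock : List Bool → List Bool := Plumb.polyFn ((C.r + 1) * (C.d + 1))

/-- The clock is polynomial-time. [cite: AroraBarak2009, §1.3] -/
theorem clock_mem_FP : C.clock ∈ FP := Plumb.polyFn_mem_FP _

/-- The clock has length `(r+1)(d+1)`. [folklore] -/
private theorem length_clock (w : List Bool) :
    (C.clock w).length = (C.r.eval w.length + 1) * (C.d.eval w.length + 1) := by
  rw [clock, Plumb.polyFn_apply, ones, List.length_replicate, eval_mul, eval_add, eval_add, eval_one]

include C in
/-- **A recursive procedure with a local certificate decides a `PSPACE` language**: if, whenever
the root call has returned, the first output bit tells membership in `L`, then `L ∈ PSPACE`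
(depth `≤ d + 1`, records and output `≤ S`, halting within `2^{(r+1)(d+1)}` rounds — all from the
certificate). [cite: HomerSelman2011, Thm. 5.13 (proof, p. 97)] [cite: AroraBarakCC2009, Thm. 4.2 and §4.1] -/
theorem mem_PSPACE_of_cert {L : Language Bool}
    (hL : ∀ w k, (P.run w k).1 = [] → (w ∈ L ↔ (P.run w k).2.getD 0 false = true)) : L ∈ PSPACE := by
  refine P.mem_PSPACE_of_halts C.clock_mem_FP (C.d + 1) C.S (fun w k => ?_) (fun w k f hf => ?_)
    (fun w k => (C.good_run w k).2) fun w => ?_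
  · obtain ⟨-, hasc, hrk⟩ := (C.good_run w k).1
    have := C.length_le_of_asc hasc hrk
    simpa [eval_add] using this
  · obtain ⟨htop, -, -⟩ := (C.good_run w k).1
    -- every record of a good stack is invariant: the top by `htop`, the others are waiting
    rcases hc : P.run w k with ⟨st, out⟩
    rw [hc] at htop hf
    cases st with
    | nil => simp at hf
    | cons g rest =>
      obtain ⟨hgI, hwait⟩ := htop g rest rfl
      simp only [List.mem_cons] at hf
      rcases hf with rfl | hf
      · exact C.size_le w _ hgI
      · exact C.size_le w _ (hwait f hf).1
  · refine ⟨2 ^ (C.clock w).length, le_rfl, ?_, hL w _ ?_⟩ <;>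
      exact C.run_halts w (by rw [C.length_clock])

end Cert

end Timing

end RecProc

end Literature.Computability.Complexity
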